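import Summits.ResolutionOfSingularities.ResolutionOfSingularities.Theorems.EquisingularLiftEquisingularLiftNatResidueHypDefsE11
import Literature.AlgebraicGeometry.Resolution.RegularSubschemeLocallyIrreducible
import Literature.AlgebraicGeometry.Resolution.BlowupSequencesBaseChange
import HarnessLib

/-!
# EL♮(3) / EL♮(n), RUNG LC «large characteristic» — bricks (B3′)(f2) and (f4): the FIBRE TOKENS (E1) and (END) of `DescTransformOK` from the
# B-side ideal-level word

leafhand-res-equisingularlift-3 g0 (prover, 2026-08-31; one-generation line-first hand on stmt-ResolutionOfSingularities-20148 / -20038 /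
-15660, cell `pub/decomp-res`).  Crux `EquisingularLiftNatThree` (`stmt-…-20148`; uniform in `n`, so also `stmt-…-20038`), line W4.5(b), RUNG LC
(idea-2 g32 `Cruxes/EquisingularLiftNatThree/LARGE-CHAR-RUNG-idea2.md` v1.6 §(B3′): after the spread, «for every `θ : A[1/a] → k`: … (f2)
`C_{i,θ}.support ⊆ Y_{i,θ}` from (s3) [`𝓘(T_i) ≤ C_i` on the B-side] + (f1); … (f4) END: `(T_r)_θ` smooth ⇒ reduced ⇒ equals the reduced induced
structure on `Y_{r,θ}` ⇒ `IsRegular (vanishingIdeal ⟨closure Y⟩).subscheme` ✓»).  The k-fibre clause of the point-wise door ✓ `DescDoorAt B k θ`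
(…NatResidueHypDefsE11 :56) is ✓ `DescTransformOK (s.comap j) (𝟙 _) (range ι) (range ι)` (…DefsE10 :60), a recursion with three tokens per stage —
(E1) `C.support ⊆ Y`, the position token, and the tail on the strict transform `closure (π⁻¹ (Y ∖ C.support))` — and the END token
`IsRegular (vanishingIdeal ⟨closure Y⟩).subscheme`.  When the B-side word carries a RUNNING IDEAL `𝓣ᵢ` (the iterated strict-transform ideal of the
universal hypersurface, (B3″)) with `𝓣ᵢ ≤ Cᵢ` and a `B`-SMOOTH last `V(𝓣_r)`, and the k-side running set is `Yᵢ = supp (j_i^* 𝓣ᵢ)` (that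
identification along the tower is LC-FIB (f1), NOT proved here), two of the four tokens are read off directly; this file proves them, DEF-FREE:

* `support_comap_subset_support_comap_of_le` — (f2)/(E1): `𝓣 ≤ C ⇒ supp (j^*C) ⊆ supp (j^*𝓣)` for ANY morphism `j` (Mathlib: `comap` monotone,
  `support` antitone);
* `descTransformOK_E1_of_le` — the same in the letters of the (E1) token: `(C.comap j).support ⊆ Y` for `Y = supp (𝓣.comap j)`;
* `isRegular_vanishingIdeal_closure_support_comap_of_smooth` — (f4)/(END): for any cartesian square `X_k = X_B ×_{Spec B} Spec k` over a field and
  any `𝓣` with `V(𝓣) → Spec B` SMOOTH, the reduced induced structure on `closure (supp (j^*𝓣)) = supp (j^*𝓣)` is REGULAR — the fibre `V(j^*𝓣)` is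
  smooth over `k` hence regular (✓ `isRegular_subscheme_comap_of_smooth`, Stacks 056S), so `j^*𝓣` IS the vanishing ideal of its support
  (✓ `eq_vanishingIdeal_support_of_isRegular`);
* `descTransformOK_nil_of_smooth` — the same as the `nil` case of ✓ `DescTransformOK` verbatim: `DescTransformOK (CentreSeq.nil X_k) σ Y₀ Y` for
  `Y = supp (j^*𝓣)`.

WHAT REMAINS of `hspread` (honest): LC-FIB (f1) «`supp (j'^* strictTransformIdeal π C 𝓣) = closure (π_k⁻¹ (supp j^*𝓣 ∖ supp j^*C))` at the points over
`D(a)`» (route: ✓ `IsEffectiveCartier.comap_fst_of_flat_subschemeι` + scheme-level generic flatness ✓ `Morphisms/GenericFlatness` for `V(𝓣') ∩ E → Spec A`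
+ «`E ∩ V(𝓣')` is Cartier in `V(𝓣')`» + dense complement of a Cartier divisor), the position token (f3) by fibre dimension, the B-side ideal word
(`𝓣ᵢ ≤ Cᵢ` spread from the K-side by ✓ `exists_comap_ι_le_comap_ι_of_generic`; END smoothness spread = ✓ `exists_forall_mem_smoothLocus_of_smooth_comap`,
…NatLargeCharSpreadCentres), and the (B5) assembly.  EL♮(3) NOT proved; EL♮ NOT proved; resolution of singularities in positive characteristic NOT
proved; nothing of [Hironaka2017] (a candidate under adjudication) is asserted or used.  [OURS · bookkeeping over Mathlib `IdealSheafData` + tree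
lemmas · standard axioms · DEF-FREE · `--supports stmt-ResolutionOfSingularities-20148 --as helper`, counted 0 · AI-written, weaker than expert review.]
[cite: StacksProject, Tag 056S] (method; index only)
-/

set_option linter.dupNamespace false -- mandated namespace `Summit.<Summit>.<Problem>` of this single-conjunct summit

noncomputable section

open CategoryTheory CategoryTheory.Limits AlgebraicGeometry TopologicalSpace
open Literature.AlgebraicGeometry.Resolution
open AlgebraicGeometry.Scheme.IdealSheafData

namespace Summit.ResolutionOfSingularities.ResolutionOfSingularities.Cruxes.EquisingularLiftNat.Sections

section E1

variable {XB Xk : Scheme.{0}} (j : Xk ⟶ XB)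

/-- **(f2)** An inclusion of ideal sheaves `𝓣 ≤ C` on the B-side gives the reverse inclusion of the supports of their pull-backs along ANY
morphism `j` (Mathlib: `comap` is monotone, `support` antitone). [folklore] -/
theorem support_comap_subset_support_comap_of_le {T C : XB.IdealSheafData} (hTC : T ≤ C) :
    ((C.comap j).support : Set Xk) ⊆ ((T.comap j).support : Set Xk) := by
  have h : (T.comap j).support ≥ (C.comap j).support := support_antitone (comap_mono j hTC)
  exact h

/-- **(E1) token of `DescTransformOK` from the ideal-level word**: if the B-side running ideal satisfies `𝓣 ≤ C` (the centre lies in the running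
strict transform, scheme-theoretically) and the k-side running set is `Y = supp (j^*𝓣)`, then `supp (j^*C) ⊆ Y`.
[OURS · L1 W4.5b · RUNG LC (B3′)(f2)] [folklore] -/
theorem descTransformOK_E1_of_le {T C : XB.IdealSheafData} (hTC : T ≤ C) (Y : Set Xk) (hY : Y = ((T.comap j).support : Set Xk)) :
    ((C.comap j).support : Set Xk) ⊆ Y := by
  rw [hY]
  exact support_comap_subset_support_comap_of_le j hTC

end E1

section END

variable {B : Type} (k : Type) [CommRing B] [Field k] [Algebra B k]
  {XB Xk : Scheme.{0}} (qB : XB ⟶ Spec (.of B)) {j : Xk ⟶ XB} {t : Xk ⟶ Spec (.of k)}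
  (HX : IsPullback j t qB (specOfAlgebra B k))

include HX

/-- **(f4)** For a cartesian square `X_k = X_B ×_{Spec B} Spec k` over a field `k` and an ideal sheaf `𝓣` on `X_B` whose closed subscheme
`V(𝓣) → Spec B` is SMOOTH, the reduced induced closed subscheme of `X_k` on `closure (supp (j^*𝓣))` is REGULAR: the fibre `V(j^*𝓣) → Spec k` is smooth
(base change), hence `V(j^*𝓣)` is regular (✓ `isRegular_subscheme_comap_of_smooth`, Stacks 056S) and reduced, so `j^*𝓣 = 𝓘(supp j^*𝓣)`
(✓ `eq_vanishingIdeal_support_of_isRegular`), and the support is closed. [cite: StacksProject, Tag 056S] [OURS · L1 W4.5b · RUNG LC (B3′)(f4)] -/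
theorem isRegular_vanishingIdeal_closure_support_comap_of_smooth (T : XB.IdealSheafData) [Smooth (T.subschemeι ≫ qB)] :
    Scheme.IsRegular (vanishingIdeal (⟨closure ((T.comap j).support : Set Xk), isClosed_closure⟩ : Closeds Xk)).subscheme := by
  have hreg : Scheme.IsRegular (T.comap j).subscheme := isRegular_subscheme_comap_of_smooth (k := k) qB T HX
  have hcl : (⟨closure ((T.comap j).support : Set Xk), isClosed_closure⟩ : Closeds Xk) = (T.comap j).support :=
    Closeds.ext (T.comap j).support.isClosed.closure_eq
  rw [hcl, ← eq_vanishingIdeal_support_of_isRegular (T.comap j) hreg]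
  exact hreg

/-- **(END) token of `DescTransformOK`**: with `Y = supp (j^*𝓣)` for a `B`-SMOOTH last `V(𝓣)`, the empty word is OK —
`DescTransformOK (CentreSeq.nil X_k) σ Y₀ Y` (its body is `IsRegular (vanishingIdeal ⟨closure Y⟩).subscheme` verbatim).
[cite: StacksProject, Tag 056S] [OURS · L1 W4.5b · RUNG LC (B3′)(f4)] -/
theorem descTransformOK_nil_of_smooth (T : XB.IdealSheafData) [Smooth (T.subschemeι ≫ qB)] {P : Scheme.{0}} (σ : Xk ⟶ P) (Y₀ : Set P)
    (Y : Set Xk) (hY : Y = ((T.comap j).support : Set Xk)) : DescTransformOK (CentreSeq.nil Xk) σ Y₀ Y := by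
  subst hY
  exact isRegular_vanishingIdeal_closure_support_comap_of_smooth k qB HX T

end END

end Summit.ResolutionOfSingularities.ResolutionOfSingularities.Cruxes.EquisingularLiftNat.Sections

end
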